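import Literature.IUT.HodgeTheaters.GlobalFrobenioidsCoricFieldLevelNonVacuity
import Literature.IUT.HodgeTheaters.GlobalFrobenioidsCoricRigidityFieldLevelOfFG
import HarnessLib

/-!
# [IUTchI] Example 5.1 (v), field-level closers with law (iv) := `hfg`: NON-VACUITY at the Galois toy `ℚ̄ ↶ G_ℚ`
# (PROOF-ONLY; NV annex A2′)

Mochizuki, *Inter-universal Teichmüller theory I*, §5, Example 5.1 (v), kurims manuscript (May 2020) p. 127 l. 57–79
(cell render lit/IUTchI-EX51v-VERBATIM.md) ([IUTchI] Ex 5.1 (v) p.127) [claim: Mochizuki2012, status: disputed]: "we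
observe that the asserted injectivity follows immediately from the corresponding injectivity in the case of
`𝕄^⊛_∞κ(†𝒟^⊚)` (respectively, `𝕄^⊛_∞κ×(†𝒟^⊚)`)" (D-0012 claim key; nothing disputed is asserted here; no side is taken
on [IUTchIII] Cor. 3.12).

Cell abc-iut, layer-5 certificate, conjunct E51/L29 at the field level.  abc-iut-w4-d050 gen 5 replaced, in
abc-iut-w4-d056's closers `NFBridgeRecon.existsUniqueCoricStructure_infκPair_fieldLevel` / `…_infκxPair_fieldLevel`
(p436822), the Kummer-injectivity LAW (iv) `h_Ex51v_div` by the STRUCTURAL hypothesis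

  `hfg : ∀ H : OpenNormalSubgroup π₁^rat, ∃ s : Finset K_rat, every H-fixed a ∈ K_rat lies in ℚ(s)`

(`…_fieldLevel_of_fg`, `GlobalFrobenioidsCoricRigidityFieldLevelOfFG.lean`, p447949; via [AbsTopIII] Rmk 1.5.4 (i)(ii),
both PROVED in the tree).  NV DISCIPLINE (DISCHARGE-L5 §E: a witness per consumer binder SET): this PROOF-ONLY file
(no `def`, no `instance`, no `structure`, no new Prop fact) shows that the NEW binder set — non-commutativity of
`π₁^rat`, `char K_rat = 0`, `hroot`, `hprim`, `h1`, `hpow`, `h1×`, `hpow×`, **`hfg`**, `h_Ex51v_ordmul`, `hpole`, `h_Ex51v_zero`,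
`h_Ex51v_polex`, `hex×`, together with the OLD (iv) `h_Ex51v_div` — is JOINTLY INHABITED at the same Galois toy as
abc-iut-w4-d050 gen 4's A2 witness (`CoricLawsToy.exists_fieldLevel_laws`, p441507; construction rebuilt verbatim —
it is proof-internal there): `K_rat := ℚ̄`, `π₁^rat := G_ℚ` (abc-iut-w4-d066's `fbarActionAlong`), `𝕄^⊛_∞κ :=` the
root-closure of the powers of `2`, `𝕄^⊛_∞κ× :=` the non-zero elements all of whose rational powers are `2`-integral,
`X := Fin 2`, `ord :=` the `2`-adic valuation on `ℚ`.  The NEW conjunct `hfg` holds because the fixed field of an OPEN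
subgroup of `G_ℚ` is FINITE over `ℚ` (Mathlib `InfiniteGalois.fixingSubgroup_fixedField`, `isOpen_iff_finite`), hence
every fixed element is a `ℚ`-combination of a finite basis and lies in `ℚ(basis)`; and the `_of_fg` closers FIRE there
(`exists_fieldLevel_of_fg_fires`).  HONEST LABEL: NV annex (A2′); DEGENERATE TOY on the function-field side with
GENUINE Galois side; inhabited ≠ discharged; no census change by itself; not a claim about the genuine
`Gal(L̄_C/L_C) ↷ L̄_C`.  typed ≠ proved; no side is taken on [IUTchIII] Cor. 3.12 (nor [IUTchI]).
-/

namespace Literature.IUT.HodgeTheaters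

namespace NFBridgeRecon

namespace CoricLawsToy

open Literature.AlgebraicGeometry.Frobenioids

/-- **Field-level binders WITH `hfg` jointly inhabited at the Galois toy `ℚ̄ ↶ G_ℚ`** (abc-iut-w4-d050 gen 4's A2 datum,
rebuilt verbatim): one datum (`N` with `char K_rat = 0`, `X := Fin 2`, `ord`) with NON-commutative `π₁^rat(†𝒟^⊛)` at
which hold `hroot`, `hprim`, `h1`, `hpow`, `h1×`, `hpow×`, the old law (iv) `h_Ex51v_div`, the NEW structural **`hfg`**
(fixed fields of open normal subgroups lie in `ℚ(s)`, `s` finite), `h_Ex51v_ordmul`, `hpole`, `h_Ex51v_zero`,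
`h_Ex51v_polex`, `hex×` — 15 conjuncts, verbatim shapes.  NV annex; inhabited ≠ discharged; no census change.
([IUTchI] Ex 5.1 (v) pp.127–128) [claim: Mochizuki2012, status: disputed] -/
theorem exists_fieldLevel_laws_fg :
    ∃ (N : NFBridgeRecon.{0}) (_ : CharZero N.Krat) (X : Type) (ord : X → N.Krat → ℤ),
      (∃ a b : N.piRat, a * b ≠ b * a) ∧
      (∀ a : N.Krat, a ≠ 0 → ∀ n : ℕ, 0 < n → ∃ b : N.Krat, b ^ n = a) ∧
      (∀ n : ℕ, 0 < n → ∃ ζ : N.Krat, IsPrimitiveRoot ζ n) ∧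
      (1 : N.Krat) ∈ N.Minfκ ∧
      (∀ (f : N.Krat) (n : ℕ), 0 < n → (f ∈ N.Minfκ ↔ f ^ n ∈ N.Minfκ)) ∧
      (1 : N.Krat) ∈ N.Minfκx ∧
      (∀ (f : N.Krat) (n : ℕ), 0 < n → (f ∈ N.Minfκx ↔ f ^ n ∈ N.Minfκx)) ∧
      (∀ (H : OpenNormalSubgroup N.piRat) (a : N.Krat), a ≠ 0 → (∀ h : N.piRat, h ∈ H → h • a = a) →
        (∀ n : ℕ+, ∃ b : N.Krat, (∀ h : N.piRat, h ∈ H → h • b = b) ∧ b ^ (n : ℕ) = a) → a = 1) ∧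
      (∀ H : OpenNormalSubgroup N.piRat, ∃ s : Finset N.Krat,
        ∀ a : N.Krat, (∀ h : N.piRat, h ∈ H → h • a = a) → a ∈ IntermediateField.adjoin ℚ (s : Set N.Krat)) ∧
      (∀ (x : X) (a b : N.Krat), a ≠ 0 → b ≠ 0 → (∀ g : N.piRat, g • a = a) → (∀ g : N.piRat, g • b = b) →
        ord x (a * b) = ord x a + ord x b) ∧
      (∀ f' ∈ N.Minfκ, (∀ g : N.piRat, g • f' = f') →
        ∀ x₁ x₂ : X, x₁ ≠ x₂ → ¬ (ord x₁ f' < 0 ∧ ord x₂ f' < 0)) ∧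
      (∃ f ∈ N.Minfκ, (∀ g : N.piRat, g • f = f) ∧ ∃ x₁ x₂ : X, x₁ ≠ x₂ ∧ 0 < ord x₁ f ∧ 0 < ord x₂ f) ∧
      (∀ f' ∈ N.Minfκx, (∀ g : N.piRat, g • f' = f') →
        ∀ x₁ x₂ : X, x₁ ≠ x₂ → ¬ (ord x₁ f' < 0 ∧ ord x₂ f' < 0)) ∧
      (∃ f ∈ N.Minfκx, (∀ g : N.piRat, g • f = f) ∧ ∃ x₁ x₂ : X, x₁ ≠ x₂ ∧ 0 < ord x₁ f ∧ 0 < ord x₂ f) := by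
  classical
  let K : Type := QuasiTemperoid.Fbar ℚ
  let G : ProfiniteGrp.{0} := absGalGrp ℚ
  let ρ : G →ₜ* QuasiTemperoid.GalFbar ℚ := ContinuousMonoidHom.id G
  letI act : MulSemiringAction G K := fbarActionAlong ℚ ρ
  haveI : IsGalois ℚ K := isGalois_fbar ℚ
  haveI : Fact (Nat.Prime 2) := ⟨Nat.prime_two⟩
  have hsmul : ∀ (g : G) (f : K), g • f = (g : QuasiTemperoid.GalFbar ℚ) f := fun _ _ => rfl
  have hinj : Function.Injective (algebraMap ℚ K) := (algebraMap ℚ K).injective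
  -- fixed elements are rational (Krull)
  have hfixed : ∀ f : K, (∀ g : G, g • f = f) → ∃ q : ℚ, f = algebraMap ℚ K q := by
    intro f hf
    obtain ⟨q, hq⟩ := IntermediateField.mem_bot.1 ((InfiniteGalois.mem_bot_iff_fixed f).2 fun g => hf g)
    exact ⟨q, hq.symm⟩
  have hfix_alg : ∀ (q : ℚ) (g : G), g • algebraMap ℚ K q = algebraMap ℚ K q :=
    fun q g => (g : QuasiTemperoid.GalFbar ℚ).commutes q
  /- the two coric sets -/
  let T : Set K := {f | ∃ m : ℕ, 0 < m ∧ ∃ a : ℕ, f ^ m = (2 : K) ^ a}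
  let S : Set K := {f | f ≠ 0 ∧ ∀ m : ℕ, 0 < m → ∀ q : ℚ, f ^ m = algebraMap ℚ K q → 0 ≤ padicValRat 2 q}
  have h2K : (2 : K) ≠ 0 := two_ne_zero
  have hv2 : padicValRat 2 (2 : ℚ) = 1 := by
    rw [show (2 : ℚ) = ((2 : ℕ) : ℚ) by norm_num, padicValRat.self one_lt_two]
  have hT1 : (1 : K) ∈ T := ⟨1, one_pos, 0, by rw [one_pow, pow_zero]⟩
  have hT0 : (0 : K) ∉ T := by
    rintro ⟨m, hm, a, h⟩
    rw [zero_pow hm.ne'] at h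
    exact pow_ne_zero a h2K h.symm
  have hTpow : ∀ (f : K) (n : ℕ), 0 < n → (f ∈ T ↔ f ^ n ∈ T) := by
    intro f n hn
    constructor
    · rintro ⟨m, hm, a, h⟩
      exact ⟨m, hm, a * n, by rw [← pow_mul, mul_comm n m, pow_mul, h, ← pow_mul]⟩
    · rintro ⟨m, hm, a, h⟩
      exact ⟨n * m, Nat.mul_pos hn hm, a, by rw [pow_mul, h]⟩
  have hTsmul : ∀ (g : G) {f : K}, f ∈ T → g • f ∈ T := by
    rintro g f ⟨m, hm, a, h⟩
    refine ⟨m, hm, a, ?_⟩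
    rw [hsmul, ← map_pow, h, map_pow, map_ofNat]
  -- the 2-adic valuation of a rational power of an element of `T` is nonnegative
  have hTval : ∀ (f : K), f ∈ T → ∀ m : ℕ, 0 < m → ∀ q : ℚ, f ^ m = algebraMap ℚ K q → 0 ≤ padicValRat 2 q := by
    rintro f ⟨m₀, hm₀, a, h⟩ m hm q hq
    -- `q ^ m₀ = 2 ^ (a m)` in `ℚ`
    have hq' : algebraMap ℚ K (q ^ m₀) = algebraMap ℚ K ((2 : ℚ) ^ (a * m)) := by
      rw [map_pow, ← hq, ← pow_mul, mul_comm m m₀, pow_mul, h, ← pow_mul, map_pow, map_ofNat]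
    have hqq : q ^ m₀ = (2 : ℚ) ^ (a * m) := hinj hq'
    have hq0 : q ≠ 0 := by
      rintro rfl
      rw [zero_pow hm₀.ne'] at hqq
      exact pow_ne_zero _ two_ne_zero hqq.symm
    have hv : (m₀ : ℤ) * padicValRat 2 q = (a * m : ℕ) * padicValRat 2 2 := by
      rw [← padicValRat.pow, ← padicValRat.pow, hqq]
    rw [hv2, mul_one] at hv
    have hm₀' : (0 : ℤ) < m₀ := by exact_mod_cast hm₀
    nlinarith [hv, Int.natCast_nonneg (a * m)]
  have hTS : T ⊆ S := fun f hf => ⟨fun h0 => hT0 (h0 ▸ hf), hTval f hf⟩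
  have hS1 : (1 : K) ∈ S := hTS hT1
  have hS0 : (0 : K) ∉ S := fun h => h.1 rfl
  have hSpow : ∀ (f : K) (n : ℕ), 0 < n → (f ∈ S ↔ f ^ n ∈ S) := by
    intro f n hn
    constructor
    · rintro ⟨hf0, hf⟩
      exact ⟨pow_ne_zero _ hf0, fun m hm q h => hf (n * m) (Nat.mul_pos hn hm) q (by rw [pow_mul, h])⟩
    · rintro ⟨hf0, hf⟩
      refine ⟨fun h0 => hf0 (by rw [h0, zero_pow hn.ne']), fun m hm q h => ?_⟩
      have hq0 : q ≠ 0 := by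
        rintro rfl
        rw [map_zero] at h
        exact hf0 (by rw [(pow_eq_zero_iff hm.ne').1 h, zero_pow hn.ne'])
      have h' := hf m hm (q ^ n) (by rw [map_pow, ← h, ← pow_mul, ← pow_mul, mul_comm])
      rw [padicValRat.pow] at h'
      have hn' : (0 : ℤ) < n := by exact_mod_cast hn
      nlinarith [h']
  have hSsmul : ∀ (g : G) {f : K}, f ∈ S → g • f ∈ S := by
    rintro g f ⟨hf0, hf⟩
    refine ⟨?_, fun m hm q h => hf m hm q ?_⟩
    · rw [hsmul]
      exact (map_ne_zero_iff _ (g : QuasiTemperoid.GalFbar ℚ).injective).2 hf0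
    · rw [hsmul, ← map_pow] at h
      have h' := congrArg (g : QuasiTemperoid.GalFbar ℚ).symm h
      have h'' : (g : QuasiTemperoid.GalFbar ℚ).symm (algebraMap ℚ K q) = algebraMap ℚ K q :=
        (g : QuasiTemperoid.GalFbar ℚ).symm.commutes q
      rw [AlgEquiv.symm_apply_apply, h''] at h'
      exact h'
  /- the interface datum -/
  let N : NFBridgeRecon.{0} :=
    { l := 5
      piDast := G
      piDcirc := ⊤
      Fbar := K
      fbarField := inferInstance
      fbarAction := act
      isOpen_stabilizer_fbar := isOpen_stabilizer_along ℚ ρ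
      piRat := G
      ratToAst := ContinuousMonoidHom.id G
      ratToAst_surjective := Function.surjective_id
      Krat := K
      kratField := inferInstance
      kratAction := act
      isOpen_stabilizer_krat := isOpen_stabilizer_along ℚ ρ
      const := RingHom.id K
      const_smul := fun _ _ => rfl
      Mκ := T
      Minfκ := T
      Minfκx := S
      mκ_subset := subset_rfl
      minfκ_subset := hTS
      zero_notMem := hS0
      smul_mem_minfκ := fun g _ hf => hTsmul g hf
      smul_mem_minfκx := fun g _ hf => hSsmul g hf
      solKer := ⊤
      solKer_normal := inferInstance
      AutD := PUnit
      autGroup := inferInstance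
      Autε := ⊤
      AutSL := ⊤
      AutSLε := ⊤
      autSLε_le := le_rfl
      autSLε_le_autε := le_rfl
      lift := fun _ => ContinuousMulEquiv.refl G }
  /- the order map: the 2-adic valuation on `ℚ`, `0` elsewhere, at both points of `X := Fin 2` -/
  let ordK : K → ℤ := fun f => if h : ∃ q : ℚ, f = algebraMap ℚ K q then padicValRat 2 h.choose else 0
  have ord_alg : ∀ q : ℚ, ordK (algebraMap ℚ K q) = padicValRat 2 q := by
    intro q
    have hh : ∃ q' : ℚ, algebraMap ℚ K q = algebraMap ℚ K q' := ⟨q, rfl⟩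
    have h1 : ordK (algebraMap ℚ K q) = padicValRat 2 hh.choose := dif_pos hh
    rw [h1, ← hinj hh.choose_spec]
  -- pole shape on the fixed elements of `S`: a fixed element is rational with `v₂ ≥ 0`
  have hpoleS : ∀ f' ∈ S, (∀ g : G, g • f' = f') → ∀ x₁ x₂ : Fin 2, x₁ ≠ x₂ → ¬ (ordK f' < 0 ∧ ordK f' < 0) := by
    intro f' hf' hfix x₁ x₂ _ h
    obtain ⟨q, rfl⟩ := hfixed f' hfix
    have hv := hf'.2 1 one_pos q (pow_one _)
    rw [ord_alg] at h
    exact (not_lt.2 hv) h.1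
  have h01 : (0 : Fin 2) ≠ 1 := by decide
  have h2T : (algebraMap ℚ K 2) ∈ T := ⟨1, one_pos, 1, by rw [pow_one, pow_one, map_ofNat]⟩
  have hex2 : 0 < ordK (algebraMap ℚ K 2) := by rw [ord_alg, hv2]; exact one_pos
  refine ⟨N, (inferInstance : CharZero K), Fin 2, fun _ => ordK, ?_, ?_, ?_, hT1, hTpow, hS1, hSpow, ?_, ?_, ?_,
    fun f' hf' hfix => hpoleS f' (hTS hf') hfix, ⟨algebraMap ℚ K 2, h2T, hfix_alg 2, 0, 1, h01, hex2, hex2⟩, hpoleS,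
    ⟨algebraMap ℚ K 2, hTS h2T, hfix_alg 2, 0, 1, h01, hex2, hex2⟩⟩
  · -- `G_ℚ` is not commutative (it is not even solvable: abc-iut-L5-t14)
    by_contra hall
    exact Literature.NumberTheory.NumberFields.absoluteGaloisGroup_not_isSolvable ℚ
      (isSolvable_of_comm fun a b => by by_contra hab; exact hall ⟨a, b, hab⟩)
  · -- `hroot`: `ℚ̄` is algebraically closed
    exact fun a _ n hn => IsAlgClosed.exists_pow_nat_eq a hn
  · -- `hprim`: all roots of unity
    intro n hn
    haveI : NeZero (n : ℚ) := ⟨by exact_mod_cast hn.ne'⟩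
    exact HasEnoughRootsOfUnity.exists_primitiveRoot K n
  · -- `h_Ex51v_div`: the fixed field of an open subgroup is a number field; there infinitely divisible ⇒ `1`
    intro H a ha hfa hroots
    let Hs : Subgroup (QuasiTemperoid.GalFbar ℚ) := H.toSubgroup
    let E : IntermediateField ℚ K := IntermediateField.fixedField Hs
    have hmemE : ∀ y : K, (∀ h : G, h ∈ H → h • y = y) → y ∈ E := by
      intro y hy
      rw [IntermediateField.mem_fixedField_iff]
      intro f hf
      exact hy f hf
    -- `E` is finite over `ℚ` because `H` is open
    let Hc : ClosedSubgroup (QuasiTemperoid.GalFbar ℚ) := ⟨Hs, H.toOpenSubgroup.isClosed⟩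
    have hfix : E.fixingSubgroup = Hs := InfiniteGalois.fixingSubgroup_fixedField Hc
    haveI : FiniteDimensional ℚ E := by
      refine (InfiniteGalois.isOpen_iff_finite E).1 ?_
      rw [hfix]
      exact H.toOpenSubgroup.isOpen'
    haveI : NumberField E := NumberField.mk
    -- transfer to `E`
    have ha' : (⟨a, hmemE a hfa⟩ : E) ≠ 0 := fun h0 => ha (congrArg Subtype.val h0)
    have hroots' : ∀ n : ℕ, 0 < n → ∃ b : E, b ^ n = ⟨a, hmemE a hfa⟩ := by
      intro n hn
      obtain ⟨b, hb, hbn⟩ := hroots ⟨n, hn⟩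
      exact ⟨⟨b, hmemE b hb⟩, Subtype.ext (by rw [IntermediateField.coe_pow]; exact hbn)⟩
    have := Literature.NumberTheory.NumberFields.eq_one_of_forall_exists_pow_eq ha' hroots'
    exact congrArg Subtype.val this
  · -- `hfg` (NEW, abc-iut-w4-d050 gen 5): the fixed field of an open normal subgroup of `G_ℚ` is FINITE over `ℚ`,
    -- hence generated by a finite set (a `ℚ`-basis): every `H`-fixed element lies in `ℚ(basis)`
    intro H
    let Hs : Subgroup (QuasiTemperoid.GalFbar ℚ) := H.toSubgroup
    let E : IntermediateField ℚ K := IntermediateField.fixedField Hs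
    have hmemE : ∀ y : K, (∀ h : G, h ∈ H → h • y = y) → y ∈ E := by
      intro y hy
      rw [IntermediateField.mem_fixedField_iff]
      intro f hf
      exact hy f hf
    let Hc : ClosedSubgroup (QuasiTemperoid.GalFbar ℚ) := ⟨Hs, H.toOpenSubgroup.isClosed⟩
    have hfix : E.fixingSubgroup = Hs := InfiniteGalois.fixingSubgroup_fixedField Hc
    haveI : FiniteDimensional ℚ E := by
      refine (InfiniteGalois.isOpen_iff_finite E).1 ?_
      rw [hfix]
      exact H.toOpenSubgroup.isOpen'
    let b := Module.finBasis ℚ E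
    refine ⟨Finset.univ.image fun i => ((b i : E) : K), fun a hfa => ?_⟩
    -- `a ∈ E` is a `ℚ`-combination of the basis; each summand lies in the subfield `ℚ(basis)`
    have haE : a ∈ E := hmemE a hfa
    set e : E := ⟨a, haE⟩ with he
    have hrepr := b.sum_repr e
    have ha_eq : a = ∑ i, ((b.repr e i : ℚ) : K) * ((b i : E) : K) := by
      have h1 : a = ((∑ i, b.repr e i • b i : E) : K) := by rw [hrepr]
      rw [h1, IntermediateField.coe_sum]
      refine Finset.sum_congr rfl fun i _ => ?_
      rw [IntermediateField.coe_smul, Algebra.smul_def, eq_ratCast]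
    rw [ha_eq]
    refine sum_mem fun i _ => mul_mem ?_ ?_
    · exact SubfieldClass.ratCast_mem _ _
    · exact IntermediateField.subset_adjoin ℚ _ (by
        rw [Finset.coe_image]
        exact ⟨i, Finset.mem_coe.mpr (Finset.mem_univ i), rfl⟩)
  · -- `h_Ex51v_ordmul`: fixed non-zero elements are rational and `v₂` is additive
    intro _ a b ha hb hfa hfb
    obtain ⟨qa, rfl⟩ := hfixed a hfa
    obtain ⟨qb, rfl⟩ := hfixed b hfb
    have hqa : qa ≠ 0 := fun h => ha (by rw [h, map_zero])
    have hqb : qb ≠ 0 := fun h => hb (by rw [h, map_zero])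
    change ordK (algebraMap ℚ K qa * algebraMap ℚ K qb) = ordK (algebraMap ℚ K qa) + ordK (algebraMap ℚ K qb)
    rw [← map_mul, ord_alg, ord_alg, ord_alg, padicValRat.mul hqa hqb]

/-- **The `_of_fg` closers FIRE at the toy** (shape check by name): abc-iut-w4-d050's
`NFBridgeRecon.existsUniqueCoricStructure_infκPair_fieldLevel_of_fg` / `…_infκxPair_fieldLevel_of_fg` (p447949) applied to the
witnesses yield `ExistsUniqueCoricStructure` for BOTH model pairs — the binder set with (iv) := `hfg` is inhabited AND
sufficient there.  NV annex; inhabited ≠ discharged. ([IUTchI] Ex 5.1 (v) p.128) [claim: Mochizuki2012, status: disputed] -/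
theorem exists_fieldLevel_of_fg_fires :
    ∃ (N : NFBridgeRecon.{0}) (_ : CharZero N.Krat), (∃ a b : N.piRat, a * b ≠ b * a) ∧
      ExistsUniqueCoricStructure N.piRat N.infκPair ∧ ExistsUniqueCoricStructure N.piRat N.infκxPair := by
  obtain ⟨N, hc, X, ord, hne, hroot, hprim, h1, hpow, h1x, hpowx, -, hfg, hordmul, hpole, hzero, hpolex, hzerox⟩ :=
    exists_fieldLevel_laws_fg
  haveI := hc
  exact ⟨N, hc, hne,
    N.existsUniqueCoricStructure_infκPair_fieldLevel_of_fg hroot hprim h1 hpow hfg ord hordmul hpole hzero,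
    N.existsUniqueCoricStructure_infκxPair_fieldLevel_of_fg hroot hprim h1x hpowx hfg ord hordmul hpolex hzerox⟩

end CoricLawsToy

end NFBridgeRecon

end Literature.IUT.HodgeTheaters
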